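import Literature.Analysis.InverseSpectral.KreinString
import Literature.Analysis.InverseSpectral.KreinStringProofs
import Literature.Analysis.InverseSpectral.KreinStringPositivity
import Literature.Analysis.InverseSpectral.KreinStringWeylSolution
import Literature.Analysis.InverseSpectral.KreinStringContinuity
import Literature.Analysis.InverseSpectral.KreinStringWeylAnalytic
import HarnessLib

/-!
# RiemannHypothesis / LeeYang — crux `LeeyangThesis`, line `Sketch`: end values from the real axis

For a Kreĭn string `S` the Neumann solutions `h ↦ φ(x, -h²)` (`x ∈ [0, L)`) are entire functions
whose Taylor coefficients (the Picard iterates) are non-negative and non-decreasing in `x`. Hence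
(`tendsto_phi_toEnd_of_real`): if the REAL end values `lim_{x → L} φ(x, -r²)` exist for every real
`r` and are the restriction of an entire function `F`, then `φ(x, -h²) → F(h)` for EVERY complex `h`
(domination `|φ(x', -h²) - φ(x, -h²)| ≤ φ(x', -|h|²) - φ(x, -|h|²)`, Cauchy along the end filter,
holomorphy of the limit by locally uniform convergence, identity theorem). This reduces the transfer
statement C⁺ of the line (`stub_xiString`: end values `ξ(1/2 + h/2)/ξ(1/2)` for all complex `h`) to
its real-axis form.
-/

noncomputable section

-- single-problem summit namespace `Summit.RiemannHypothesis.RiemannHypothesis.…` (D-0017)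
set_option linter.dupNamespace false

open MeasureTheory Filter Topology Complex Set Metric
open scoped ENNReal
open Literature.Analysis.InverseSpectral

namespace Summit.RiemannHypothesis.RiemannHypothesis.Theorems.LeeYangTelegraphString

/-! ### Domination of increments in `x` by increments on the negative axis -/

/-- The Picard coefficients `φₙ(x)` are non-decreasing in `x` on `[0, L)` (all `n`). [folklore] -/
theorem picard_one_mono (S : KreinString) (n : ℕ) {x x' : ℝ} (hx : 0 ≤ x) (hxx' : x ≤ x')
    (hx' : x' ∈ S.dom) :
    S.picard (fun _ => (1 : ℝ)) n x ≤ S.picard (fun _ => (1 : ℝ)) n x' := by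
  cases n with
  | zero => simp
  | succ n => exact S.picard_succ_mono continuous_const (fun _ _ => zero_le_one) n hx hxx' hx'

/-- **Domination of `x`-increments.** For `0 ≤ x ≤ x' < L` and every `z ∈ ℂ`:
`‖φ(x', z) - φ(x, z)‖ ≤ Re φ(x', -‖z‖) - Re φ(x, -‖z‖)` (termwise on the Picard series, whose
coefficients are `≥ 0` and non-decreasing in `x`). [folklore] -/
theorem norm_phi_sub_phi_le_re_sub (S : KreinString) {x x' : ℝ} (hx : 0 ≤ x) (hxx' : x ≤ x')
    (hx' : x' ∈ S.dom) (z : ℂ) :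
    ‖S.phi z x' - S.phi z x‖ ≤ (S.phi (-(‖z‖ : ℂ)) x').re - (S.phi (-(‖z‖ : ℂ)) x).re := by
  have hxd : x ∈ S.dom := ⟨hx, lt_of_le_of_lt (ENNReal.ofReal_le_ofReal hxx') hx'.2⟩
  set p : ℕ → ℝ → ℝ := fun n y => S.picard (fun _ => (1 : ℝ)) n y with hp
  have hs' := S.summable_picard_term continuous_const z hx' (f := fun _ => (1 : ℝ))
  have hs := S.summable_picard_term continuous_const z hxd (f := fun _ => (1 : ℝ))
  have hr' := S.summable_picard_neg continuous_const ‖z‖ hx' (f := fun _ => (1 : ℝ))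
  have hr := S.summable_picard_neg continuous_const ‖z‖ hxd (f := fun _ => (1 : ℝ))
  rw [S.phi_eq, S.phi_neg_re, S.phi_neg_re]
  simp only
  rw [← hs'.tsum_sub hs, ← hr'.tsum_sub hr]
  have hterm : ∀ n, ‖(-z) ^ n * (S.picard (fun _ => (1 : ℝ)) n x' : ℂ) -
      (-z) ^ n * (S.picard (fun _ => (1 : ℝ)) n x : ℂ)‖ =
      ‖z‖ ^ n * S.picard (fun _ => (1 : ℝ)) n x' - ‖z‖ ^ n * S.picard (fun _ => (1 : ℝ)) n x := by
    intro n
    rw [← mul_sub, norm_mul, norm_pow, norm_neg, ← Complex.ofReal_sub, Complex.norm_real,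
      Real.norm_eq_abs, abs_of_nonneg (sub_nonneg.2 (picard_one_mono S n hx hxx' hx')), mul_sub]
  calc ‖∑' n, ((-z) ^ n * (S.picard (fun _ => (1 : ℝ)) n x' : ℂ) -
        (-z) ^ n * (S.picard (fun _ => (1 : ℝ)) n x : ℂ))‖
      ≤ ∑' n, ‖(-z) ^ n * (S.picard (fun _ => (1 : ℝ)) n x' : ℂ) -
        (-z) ^ n * (S.picard (fun _ => (1 : ℝ)) n x : ℂ)‖ := by
        refine norm_tsum_le_tsum_norm ?_
        simp_rw [hterm]
        exact hr'.sub hr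
    _ = ∑' n, (‖z‖ ^ n * S.picard (fun _ => (1 : ℝ)) n x' - ‖z‖ ^ n * S.picard (fun _ => (1 : ℝ)) n x) :=
        tsum_congr hterm

/-- The negative-axis increments are monotone in the parameter: for `0 ≤ s ≤ s'` and
`0 ≤ x ≤ x' < L`, `Re φ(x', -s) - Re φ(x, -s) ≤ Re φ(x', -s') - Re φ(x, -s')`. [folklore] -/
theorem phi_neg_re_sub_mono_param (S : KreinString) {x x' : ℝ} (hx : 0 ≤ x) (hxx' : x ≤ x')
    (hx' : x' ∈ S.dom) {s s' : ℝ} (hs : 0 ≤ s) (hss' : s ≤ s') :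
    (S.phi (-(s : ℂ)) x').re - (S.phi (-(s : ℂ)) x).re ≤
      (S.phi (-(s' : ℂ)) x').re - (S.phi (-(s' : ℂ)) x).re := by
  have hxd : x ∈ S.dom := ⟨hx, lt_of_le_of_lt (ENNReal.ofReal_le_ofReal hxx') hx'.2⟩
  have h1' := S.summable_picard_neg continuous_const s hx' (f := fun _ => (1 : ℝ))
  have h1 := S.summable_picard_neg continuous_const s hxd (f := fun _ => (1 : ℝ))
  have h2' := S.summable_picard_neg continuous_const s' hx' (f := fun _ => (1 : ℝ))
  have h2 := S.summable_picard_neg continuous_const s' hxd (f := fun _ => (1 : ℝ))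
  rw [S.phi_neg_re, S.phi_neg_re, S.phi_neg_re, S.phi_neg_re, ← h1'.tsum_sub h1, ← h2'.tsum_sub h2]
  refine (h1'.sub h1).tsum_le_tsum (fun n => ?_) (h2'.sub h2)
  rw [← mul_sub, ← mul_sub]
  exact mul_le_mul_of_nonneg_right (pow_le_pow_left₀ hs hss' n)
    (sub_nonneg.2 (picard_one_mono S n hx hxx' hx'))

/-! ### The end filter -/

/-- The end filter of a Kreĭn string is proper. [folklore] -/
theorem toEnd_neBot (S : KreinString) : S.toEnd.NeBot :=
  S.tendsto_exhaust.neBot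

/-- A non-decreasing function on `[0, L)` with a limit along the end filter is bounded by it.
[folklore] -/
theorem le_of_monotoneOn_of_tendsto (S : KreinString) {g : ℝ → ℝ} {G : ℝ} (hg : MonotoneOn g S.dom)
    (hlim : Tendsto g S.toEnd (𝓝 G)) {x : ℝ} (hx : x ∈ S.dom) : g x ≤ G := by
  haveI := toEnd_neBot S
  refine ge_of_tendsto hlim ?_
  filter_upwards [S.eventually_mem_dom_ge hx] with y hy
  exact hg hx hy.1 hy.2

/-! ### From real to complex end values -/

/-- **End values from the real axis.** If for every real `r` the end value
`lim_{x → L} φ(x, -r²)` exists and equals `F(r)` for an ENTIRE function `F`, then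
`lim_{x → L} φ(x, -h²) = F(h)` for every complex `h`. [folklore] -/
theorem tendsto_phi_toEnd_of_real (S : KreinString) {F : ℂ → ℂ} (hF : Differentiable ℂ F)
    (hreal : ∀ r : ℝ, Tendsto (fun x => S.phi (-(r : ℂ) ^ 2) x) S.toEnd (𝓝 (F r))) (h : ℂ) :
    Tendsto (fun x => S.phi (-h ^ 2) x) S.toEnd (𝓝 (F h)) := by
  haveI := toEnd_neBot S
  set x : ℕ → ℝ := S.exhaust with hxdef
  have hxdom : ∀ k, x k ∈ S.dom := S.exhaust_mem_dom
  have hxmono : Monotone x := S.monotone_exhaust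
  -- the negative-axis majorants `g R y = Re φ(y, -R²)` and their limits `G R = Re F(R)`
  set g : ℝ → ℝ → ℝ := fun R y => (S.phi (-((R ^ 2 : ℝ) : ℂ)) y).re with hgdef
  have hR2 : ∀ R : ℝ, -(R : ℂ) ^ 2 = -((R ^ 2 : ℝ) : ℂ) := fun R => by push_cast; ring
  have hglim : ∀ R : ℝ, Tendsto (g R) S.toEnd (𝓝 (F R).re) := by
    intro R
    have := (Complex.continuous_re.tendsto _).comp (hreal R)
    simpa only [hgdef, hR2, Function.comp_def] using this
  have hgmono : ∀ R : ℝ, MonotoneOn (g R) S.dom := fun R => S.monotoneOn_phi_neg_re (sq_nonneg R)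
  have hgle : ∀ R : ℝ, ∀ {y : ℝ}, y ∈ S.dom → g R y ≤ (F R).re :=
    fun R {y} hy => le_of_monotoneOn_of_tendsto S (hgmono R) (hglim R) hy
  -- domination: for `‖w‖ ≤ R` and `0 ≤ y ≤ y' < L`, `‖φ(y', -w²) - φ(y, -w²)‖ ≤ g R y' - g R y`
  have hdom : ∀ (R : ℝ) (w : ℂ), ‖w‖ ≤ R → ∀ {y y' : ℝ}, 0 ≤ y → y ≤ y' → y' ∈ S.dom →
      ‖S.phi (-w ^ 2) y' - S.phi (-w ^ 2) y‖ ≤ g R y' - g R y := by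
    intro R w hw y y' hy hyy' hy'
    have h1 := norm_phi_sub_phi_le_re_sub S hy hyy' hy' (-w ^ 2)
    have hn : ‖-w ^ 2‖ = ‖w‖ ^ 2 := by rw [norm_neg, norm_pow]
    rw [hn] at h1
    refine h1.trans ?_
    have h2 := phi_neg_re_sub_mono_param S hy hyy' hy' (sq_nonneg ‖w‖)
      (pow_le_pow_left₀ (norm_nonneg w) hw 2)
    simpa only [hgdef, Complex.ofReal_pow] using h2
  -- Step A: for every complex `w`, the sequence `φ(x k, -w²)` is Cauchy, hence converges
  have hcauchy : ∀ w : ℂ, CauchySeq fun k => S.phi (-w ^ 2) (x k) := by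
    intro w
    refine Metric.cauchySeq_iff'.2 fun ε hε => ?_
    have hev : ∀ᶠ k in atTop, (F ‖w‖).re - g ‖w‖ (x k) < ε := by
      have := ((hglim ‖w‖).comp S.tendsto_exhaust)
      have h0 : Tendsto (fun k => (F ‖w‖).re - g ‖w‖ (x k)) atTop (𝓝 0) := by
        simpa using ((tendsto_const_nhds (x := (F ‖w‖).re)).sub this)
      exact (tendsto_order.1 h0).2 ε hε
    obtain ⟨K, hK⟩ := eventually_atTop.1 hev
    refine ⟨K, fun k hk => ?_⟩
    rw [dist_eq_norm]
    calc ‖S.phi (-w ^ 2) (x k) - S.phi (-w ^ 2) (x K)‖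
        ≤ g ‖w‖ (x k) - g ‖w‖ (x K) := hdom ‖w‖ w le_rfl (hxdom K).1 (hxmono hk) (hxdom k)
      _ ≤ (F ‖w‖).re - g ‖w‖ (x K) := sub_le_sub_right (hgle ‖w‖ (hxdom k)) _
      _ < ε := hK K le_rfl
  set Φ : ℂ → ℂ := fun w => limUnder atTop fun k => S.phi (-w ^ 2) (x k) with hΦdef
  have hΦ : ∀ w : ℂ, Tendsto (fun k => S.phi (-w ^ 2) (x k)) atTop (𝓝 (Φ w)) :=
    fun w => (hcauchy w).tendsto_limUnder
  -- uniform error bound: `‖Φ w - φ(x k, -w²)‖ ≤ Re F(R) - g R (x k)` for `‖w‖ ≤ R`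
  have herr : ∀ (R : ℝ) (w : ℂ), ‖w‖ ≤ R → ∀ k, ‖Φ w - S.phi (-w ^ 2) (x k)‖ ≤ (F R).re - g R (x k) := by
    intro R w hw k
    have h1 : Tendsto (fun m => ‖S.phi (-w ^ 2) (x m) - S.phi (-w ^ 2) (x k)‖) atTop
        (𝓝 ‖Φ w - S.phi (-w ^ 2) (x k)‖) := ((hΦ w).sub tendsto_const_nhds).norm
    refine le_of_tendsto h1 (eventually_atTop.2 ⟨k, fun m hm => ?_⟩)
    calc ‖S.phi (-w ^ 2) (x m) - S.phi (-w ^ 2) (x k)‖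
        ≤ g R (x m) - g R (x k) := hdom R w hw (hxdom k).1 (hxmono hm) (hxdom m)
      _ ≤ (F R).re - g R (x k) := sub_le_sub_right (hgle R (hxdom m)) _
  have herr0 : ∀ R : ℝ, Tendsto (fun k => (F R).re - g R (x k)) atTop (𝓝 0) := by
    intro R
    simpa using ((tendsto_const_nhds (x := (F R).re)).sub ((hglim R).comp S.tendsto_exhaust))
  -- Step B: convergence along the end filter to `Φ w`
  have hend : ∀ w : ℂ, Tendsto (fun y => S.phi (-w ^ 2) y) S.toEnd (𝓝 (Φ w)) := by
    intro w
    refine Metric.tendsto_nhds.2 fun ε hε => ?_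
    obtain ⟨K, hK⟩ := eventually_atTop.1 ((tendsto_order.1 (herr0 ‖w‖)).2 (ε / 2) (by positivity))
    filter_upwards [S.eventually_mem_dom_ge (hxdom K)] with y hy
    rw [dist_eq_norm]
    calc ‖S.phi (-w ^ 2) y - Φ w‖
        ≤ ‖S.phi (-w ^ 2) y - S.phi (-w ^ 2) (x K)‖ + ‖S.phi (-w ^ 2) (x K) - Φ w‖ :=
          norm_sub_le_norm_sub_add_norm_sub _ _ _
      _ ≤ (g ‖w‖ y - g ‖w‖ (x K)) + ((F ‖w‖).re - g ‖w‖ (x K)) := by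
          refine add_le_add (hdom ‖w‖ w le_rfl (hxdom K).1 hy.2 hy.1) ?_
          rw [norm_sub_rev]; exact herr ‖w‖ w le_rfl K
      _ ≤ ((F ‖w‖).re - g ‖w‖ (x K)) + ((F ‖w‖).re - g ‖w‖ (x K)) :=
          add_le_add (sub_le_sub_right (hgle ‖w‖ hy.1) _) le_rfl
      _ < ε := by linarith [hK K le_rfl]
  -- Step C: `Φ = F` on the real axis
  have hΦreal : ∀ r : ℝ, Φ r = F r := fun r => tendsto_nhds_unique (hend r) (hreal r)
  -- Step D: `Φ` is entire, as a locally uniform limit of the entire functions `w ↦ φ(x k, -w²)`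
  have hdiffk : ∀ k, Differentiable ℂ fun w : ℂ => S.phi (-w ^ 2) (x k) := fun k =>
    (S.differentiable_phi (hxdom k)).comp (differentiable_pow 2).neg
  have hΦdiff : Differentiable ℂ Φ := by
    have hloc : TendstoLocallyUniformlyOn (fun k (w : ℂ) => S.phi (-w ^ 2) (x k)) Φ atTop univ := by
      refine Metric.tendstoLocallyUniformlyOn_iff.2 fun ε hε w _ => ?_
      refine ⟨ball w 1, mem_nhdsWithin_of_mem_nhds (ball_mem_nhds w one_pos), ?_⟩
      obtain ⟨K, hK⟩ := eventually_atTop.1 ((tendsto_order.1 (herr0 (‖w‖ + 1))).2 ε hε)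
      refine eventually_atTop.2 ⟨K, fun k hk v hv => ?_⟩
      have hv' : ‖v‖ ≤ ‖w‖ + 1 := by
        have := mem_ball_iff_norm.1 hv
        linarith [norm_le_norm_add_norm_sub' v w, norm_sub_rev v w]
      rw [dist_eq_norm]
      calc ‖Φ v - S.phi (-v ^ 2) (x k)‖ ≤ (F ((‖w‖ + 1 : ℝ) : ℂ)).re - g (‖w‖ + 1) (x k) :=
            herr _ v hv' k
        _ ≤ (F ((‖w‖ + 1 : ℝ) : ℂ)).re - g (‖w‖ + 1) (x K) :=
            sub_le_sub_left (hgmono _ (hxdom K) (hxdom k) (hxmono hk)) _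
        _ < ε := hK K le_rfl
    have := hloc.differentiableOn (Eventually.of_forall fun k => (hdiffk k).differentiableOn)
      isOpen_univ
    exact differentiableOn_univ.1 this
  -- Step E: identity theorem
  have hΦF : Φ = F := by
    refine AnalyticOnNhd.eq_of_frequently_eq (z₀ := (0 : ℂ))
      (analyticOnNhd_univ_iff_differentiable.2 hΦdiff) (analyticOnNhd_univ_iff_differentiable.2 hF) ?_
    rw [frequently_nhdsWithin_iff, Metric.nhds_basis_ball.frequently_iff]
    intro ε hε
    refine ⟨((ε / 2 : ℝ) : ℂ), ?_, hΦreal _, ?_⟩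
    · rw [mem_ball, dist_zero_right, Complex.norm_real, Real.norm_eq_abs, abs_of_pos (by positivity)]
      linarith
    · rw [mem_compl_iff, mem_singleton_iff, Complex.ofReal_eq_zero]
      exact (by positivity : (0 : ℝ) < ε / 2).ne'
  rw [← hΦF]
  exact hend h

/-- **Stub realToComplex (registered form of `tendsto_phi_toEnd_of_real`).** Real end values that
are the trace of an entire function extend to complex end values. [folklore] -/
theorem stub_realToComplex : ∀ (S : KreinString) (F : ℂ → ℂ), Differentiable ℂ F →
    (∀ r : ℝ, Tendsto (fun x => S.phi (-(r : ℂ) ^ 2) x) S.toEnd (𝓝 (F r))) →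
    ∀ h : ℂ, Tendsto (fun x => S.phi (-h ^ 2) x) S.toEnd (𝓝 (F h)) :=
  fun S _ hF hreal h => tendsto_phi_toEnd_of_real S hF hreal h

end Summit.RiemannHypothesis.RiemannHypothesis.Theorems.LeeYangTelegraphString

end
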